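import Mathlib.RingTheory.UniqueFactorizationDomain.Basic
import Mathlib.RingTheory.Ideal.Maps
import Mathlib.RingTheory.Coprime.Basic
import HarnessLib

/-!
# Denominators divide a power of `g` when the prime divisors off `V(g)` contract to principal primes

Topic: `Literature/AlgebraicGeometry/Resolution`. PROOF side of `CossartPiltant2019ReductionP`
(`ArithmeticalThreefoldsLocal.lean`), input (C4), [CoP1] Prop. 8.1 (1) (V. Cossart,
O. Piltant, HAL hal-00139124, p. 22: "`S₁ < S₂`, `(S₁)_f = (S₂)_f`"). The hypothesis `hMono`
of `head_conclusion_of_monomialization` (`Prop81HeadOfGlue.lean`) asks that the generators of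
the finer local uniformization `B ⊇ A` be quotients `p/q` of elements of `A` with `q ∣ gᴺ` IN
`B`. This file PROVES the commutative-algebra half of that clause
(`map_dvd_pow_of_isRelPrime_of_comap_span_prime`): if `A` and `B` are factorial and every
prime element `ϖ` of `B` not dividing `g` generates an ideal contracting to a principal prime
ideal `(π)` of `A` — the algebraic shadow of "the modification `Spec B → Spec A` is an
isomorphism off `V(g)`", exceptional prime divisors lying over `V(g)` — then for `p/q` in
lowest terms in `A` lying in `B` (`q ∣ p` in `B`), `q` divides a power of `g` in `B`. What
remains for `hMono` is the scheme-theoretic half: the contraction property at the point of the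
embedded resolution dominated by the valuation.

Everything is PROVED; no named facts, definitions, instances or notation are introduced.

## Sources

* V. Cossart, O. Piltant, J. Algebra 320 (2008) 1051–1082: Prop. 8.1 (1) and its proof (HAL
  hal-00139124, p. 22). [CossartPiltant2008]
-/

namespace Literature.AlgebraicGeometry.Resolution

section Denominators

variable {A B : Type*} [CommRing A] [CommRing B] [IsDomain B] [UniqueFactorizationMonoid B]

omit [IsDomain B]

/-- In a factorial domain, if every prime divisor of `b ≠ 0` divides `c`, then `b` divides a
power of `c`. [folklore] -/
private theorem dvd_pow_of_forall_prime_dvd (c : B) :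
    ∀ b : B, b ≠ 0 → (∀ ϖ : B, Prime ϖ → ϖ ∣ b → ϖ ∣ c) → ∃ N : ℕ, b ∣ c ^ N := by
  intro b
  refine UniqueFactorizationMonoid.induction_on_prime b (fun h => absurd rfl h)
    (fun x hx _ _ => ⟨0, by rw [pow_zero]; exact hx.dvd⟩) ?_
  intro a ϖ ha hϖ ih _ hdiv
  obtain ⟨N, hN⟩ := ih ha fun ϖ' hϖ' hϖ'a => hdiv ϖ' hϖ' (hϖ'a.mul_left ϖ)
  refine ⟨N + 1, ?_⟩
  rw [pow_succ']
  exact mul_dvd_mul (hdiv ϖ hϖ (dvd_mul_right ϖ a)) hN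

/-- **Denominators divide a power of `g`** ([CoP1] Prop. 8.1 (1), algebraic half): let
`f : A → B` be a ring map of factorial domains and `g ∈ A`; assume every prime element `ϖ` of
`B` not dividing `f g` generates an ideal whose contraction to `A` is generated by a prime
element. If `p, q ∈ A` are relatively prime and `f q ∣ f p` in `B` (i.e. `p/q ∈ B`),
`f q ≠ 0`, then `f q ∣ (f g)ᴺ` for some `N`. [cite: CossartPiltant2008, Prop. 8.1 (1) (HAL p. 22)] -/
theorem map_dvd_pow_of_isRelPrime_of_comap_span_prime (f : A →+* B) (g : A)
    (hEXC : ∀ ϖ : B, Prime ϖ → ¬ ϖ ∣ f g →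
      ∃ π : A, Prime π ∧ Ideal.comap f (Ideal.span {ϖ}) = Ideal.span {π})
    (p q : A) (hq : f q ≠ 0) (hpq : IsRelPrime p q) (hz : f q ∣ f p) :
    ∃ N : ℕ, f q ∣ f g ^ N := by
  refine dvd_pow_of_forall_prime_dvd (f g) (f q) hq fun ϖ hϖ hϖq => ?_
  by_contra hϖg
  obtain ⟨π, hπ, hcomap⟩ := hEXC ϖ hϖ hϖg
  have hiff : ∀ a : A, ϖ ∣ f a ↔ π ∣ a := fun a => by
    rw [← Ideal.mem_span_singleton, ← Ideal.mem_span_singleton, ← hcomap, Ideal.mem_comap]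
  have hπq : π ∣ q := (hiff q).mp hϖq
  have hπp : π ∣ p := (hiff p).mp (hϖq.trans hz)
  exact hπ.not_unit (hpq hπp hπq)

/-! ### The clause of `hMono` for subrings of a field -/

/-- **The denominator clause of `hMono` from EXC, for local rings inside a field.** Let
`R ≤ R′` be subrings of a field `E`, both factorial, `G ∈ R`, and assume EXC: every prime
element of `R′` not dividing `G` generates an ideal whose contraction to `R` is generated by
a prime element. Then every `z ∈ R′` that is a fraction of elements of `R` is `b/a` with
`a, b ∈ R`, `a ≠ 0`, `a ∣ Gᴺ` in `R′` — the clause consumed by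
`exists_model_tracked_of_denominators` / `head_conclusion_of_monomialization`.
[cite: CossartPiltant2008, Prop. 8.1 (1) (HAL p. 22)] -/
theorem exists_denominator_dvd_pow_of_comap_span_prime {E : Type*} [Field E]
    (R R' : Subring E) (hRR' : R ≤ R') (hR : UniqueFactorizationMonoid R)
    (hR' : UniqueFactorizationMonoid R') (G : E) (hG : G ∈ R)
    (hEXC : ∀ ϖ : R', Prime ϖ → ¬ ϖ ∣ ⟨G, hRR' hG⟩ →
      ∃ π : R, Prime π ∧
        Ideal.comap (Subring.inclusion hRR') (Ideal.span {ϖ}) = Ideal.span {π})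
    (z : E) (hzR' : z ∈ R') (hzfrac : ∃ a b : E, a ∈ R ∧ b ∈ R ∧ b ≠ 0 ∧ z = a / b) :
    ∃ a b : E, a ∈ R ∧ b ∈ R ∧ a ≠ 0 ∧ z * a = b ∧
      ∃ (N : ℕ) (c : E), c ∈ R' ∧ G ^ N = a * c := by
  haveI := hR
  haveI := hR'
  obtain ⟨a₀, b₀, ha₀, hb₀, hb₀0, hz⟩ := hzfrac
  -- lowest terms in `R`
  have hb₀0' : (⟨b₀, hb₀⟩ : R) ≠ 0 := fun h => hb₀0 (congrArg Subtype.val h)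
  obtain ⟨q, p, c₀, hqp, hcq, hcp⟩ :=
    UniqueFactorizationMonoid.exists_reduced_factors (⟨b₀, hb₀⟩ : R) hb₀0' ⟨a₀, ha₀⟩
  have hcq' : (c₀ : E) * q = b₀ := congrArg Subtype.val hcq
  have hcp' : (c₀ : E) * p = a₀ := congrArg Subtype.val hcp
  have hc₀0 : (c₀ : E) ≠ 0 := fun h => hb₀0 (by rw [← hcq', h, zero_mul])
  have hq0 : (q : E) ≠ 0 := fun h => hb₀0 (by rw [← hcq', h, mul_zero])
  have hzq : z * q = p := by
    rw [hz, ← hcq', ← hcp', mul_div_mul_left _ _ hc₀0, div_mul_cancel₀ _ hq0]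
  -- `q ∣ p` in `R′` since `z ∈ R′`
  have hdvd : Subring.inclusion hRR' q ∣ Subring.inclusion hRR' p :=
    ⟨⟨z, hzR'⟩, Subtype.ext (by
      change ((p : E)) = (q : E) * z
      rw [mul_comm, hzq])⟩
  have hq0' : Subring.inclusion hRR' q ≠ 0 := fun h => hq0 (congrArg Subtype.val h)
  obtain ⟨N, c, hc⟩ := map_dvd_pow_of_isRelPrime_of_comap_span_prime (Subring.inclusion hRR')
    ⟨G, hG⟩ hEXC p q hq0' hqp.symm hdvd
  refine ⟨q, p, q.2, p.2, hq0, hzq, N, c, c.2, ?_⟩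
  have := congrArg Subtype.val hc
  simpa using this

end Denominators

end Literature.AlgebraicGeometry.Resolution
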